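import Literature.Topology.FourManifolds.SaddleModel
import Mathlib.Analysis.SpecialFunctions.Trigonometric.DerivHyp
import HarnessLib

/-!
# Milnor's model flow as `cosh t · id + sinh t · F`: coordinates, smoothness, and its symmetries

Topic `Literature/Topology/FourManifolds` (support file for the two-field handle-extension
endgame of `stmt-SmoothPoincare4-15190`, after `BasinPairConj.lean`).  Milnor, *Lectures on the
h-cobordism theorem* (1965), Def. 3.1 (2) (PDF p. 12): about a critical point of index `λ = k`
the gradient-like field has coordinates `F(u) = (-u₁, …, -u_k, u_{k+1}, …, uₘ)`
(`Literature.Topology.FourManifolds.milnorModelField k`), and (proof of Thm. 3.12, PDF p. 18) its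
trajectories are `t ↦ (e^{-t} x⃗, e^{t} y⃗)` — the tree's
`Literature.Topology.FourManifolds.milnorFlow k t` (`SaddleModel.lean`).

Everything here is in the model space `ℝᵐ` and **proved**; no new definitions.  We add to the
API of `milnorFlow`: the coordinate formula, the identity `Φ_t = cosh t · id + sinh t · F`,
linearity, joint smoothness in `(t, u)`, the values of `|x⃗|², |y⃗|²` along the flow, the
identity `Q(u) = ⟪F u, u⟫` for Milnor's quadratic form, and — the point of the file — that a
**linear isometry `S` commuting with `F`** preserves `Q`, `|x⃗|²`, `|y⃗|²` and commutes with the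
whole flow (no coordinates needed: `Φ_t` is a polynomial in `F`).  Such `S` (e.g.
`diag(±1, R)`, `R ∈ O(m - 1)`, for `k = 1`) are the symmetries through which two Milnor charts
at two saddles are compared.

## References

* J. Milnor, *Lectures on the h-cobordism theorem*, notes by L. Siebenmann and J. Sondow,
  Princeton Mathematical Notes (1965): Def. 3.1 (PDF pp. 11–12), proof of Thm. 3.12
  (PDF p. 18).  Held: `lit read book:milnornd-lectures-h-cobordism-theorem`.
  [MilnorHCobordism1965]
-/

open Set Function Filter
open scoped ContDiff Topology

noncomputable section

namespace Literature.Topology.FourManifolds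

variable {m : ℕ}

/-! ### Coordinates, the `cosh / sinh` form, linearity, smoothness -/

/-- Coordinates of the model flow: `e^{-t} uᵢ` for `i < k`, `e^{t} uᵢ` for `i ≥ k`. [cite: MilnorHCobordism1965, proof of Thm. 3.12 (PDF p. 18)] -/
theorem milnorFlow_apply (k : ℕ) (t : ℝ) (u : EuclideanSpace ℝ (Fin m)) (i : Fin m) :
    milnorFlow k t u i = if (i : ℕ) < k then Real.exp (-t) * u i else Real.exp t * u i := by
  simp only [milnorFlow, PiLp.add_apply, PiLp.smul_apply, smul_eq_mul, xPart_apply, yPart_apply]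
  split_ifs with h <;> ring

/-- **`Φ_t = cosh t · id + sinh t · F`.** [folklore] -/
theorem milnorFlow_eq_cosh_smul_add_sinh_smul (k : ℕ) (t : ℝ) (u : EuclideanSpace ℝ (Fin m)) :
    milnorFlow k t u = Real.cosh t • u + Real.sinh t • milnorModelField k u := by
  ext i
  simp only [milnorFlow_apply, PiLp.add_apply, PiLp.smul_apply, smul_eq_mul, milnorModelField_apply]
  rw [Real.cosh_eq, Real.sinh_eq]
  split_ifs with h <;> ring

/-- `Φ_t 0 = 0`: the origin is stationary. [folklore] -/
@[simp] theorem milnorFlow_apply_zero (k : ℕ) (t : ℝ) :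
    milnorFlow k t (0 : EuclideanSpace ℝ (Fin m)) = 0 := by
  simp [milnorFlow]

/-- The model flow is additive in the space variable. [folklore] -/
theorem milnorFlow_add_apply (k : ℕ) (t : ℝ) (u w : EuclideanSpace ℝ (Fin m)) :
    milnorFlow k t (u + w) = milnorFlow k t u + milnorFlow k t w := by
  simp only [milnorFlow, xPart_add, yPart_add, smul_add]; abel

/-- The model flow is homogeneous in the space variable. [folklore] -/
theorem milnorFlow_smul (k : ℕ) (t a : ℝ) (u : EuclideanSpace ℝ (Fin m)) :
    milnorFlow k t (a • u) = a • milnorFlow k t u := by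
  simp only [milnorFlow, xPart_smul, yPart_smul, smul_add, smul_comm a]

/-- `Φ_{-t} ∘ Φ_t = id`. [folklore] -/
theorem milnorFlow_neg_milnorFlow (k : ℕ) (t : ℝ) (u : EuclideanSpace ℝ (Fin m)) :
    milnorFlow k (-t) (milnorFlow k t u) = u := by
  rw [milnorFlow_add, neg_add_cancel, milnorFlow_zero]

/-- `Φ_t ∘ Φ_{-t} = id`. [folklore] -/
theorem milnorFlow_milnorFlow_neg (k : ℕ) (t : ℝ) (u : EuclideanSpace ℝ (Fin m)) :
    milnorFlow k t (milnorFlow k (-t) u) = u := by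
  rw [milnorFlow_add, add_neg_cancel, milnorFlow_zero]

/-- The model field commutes with its flow. [folklore] -/
theorem milnorModelField_milnorFlow (k : ℕ) (t : ℝ) (u : EuclideanSpace ℝ (Fin m)) :
    milnorModelField k (milnorFlow k t u) = milnorFlow k t (milnorModelField k u) := by
  ext i
  simp only [milnorModelField_apply, milnorFlow_apply]
  split_ifs <;> ring

/-- **The model flow is jointly smooth** in `(t, u)`. [folklore] -/
theorem contDiff_milnorFlow (k : ℕ) :
    ContDiff ℝ ∞ (fun p : ℝ × EuclideanSpace ℝ (Fin m) => milnorFlow k p.1 p.2) := by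
  have h : (fun p : ℝ × EuclideanSpace ℝ (Fin m) => milnorFlow k p.1 p.2) =
      fun p => Real.cosh p.1 • p.2 + Real.sinh p.1 • milnorModelField k p.2 :=
    funext fun p => milnorFlow_eq_cosh_smul_add_sinh_smul k p.1 p.2
  rw [h]
  exact ((Real.contDiff_cosh.comp contDiff_fst).smul contDiff_snd).add
    ((Real.contDiff_sinh.comp contDiff_fst).smul ((contDiff_milnorModelField k).comp contDiff_snd))

/-- The model flow is smooth in `u` at fixed time. [folklore] -/
theorem contDiff_milnorFlow_right (k : ℕ) (t : ℝ) :
    ContDiff ℝ ∞ (milnorFlow (m := m) k t) := by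
  have h : (milnorFlow (m := m) k t) = fun u => Real.cosh t • u + Real.sinh t • milnorModelField k u :=
    funext fun u => milnorFlow_eq_cosh_smul_add_sinh_smul k t u
  rw [h]
  exact ((contDiff_const (c := Real.cosh t)).smul contDiff_id).add
    ((contDiff_const (c := Real.sinh t)).smul (contDiff_milnorModelField k))

/-- The model flow is continuous in `(t, u)`. [folklore] -/
theorem continuous_milnorFlow (k : ℕ) :
    Continuous (fun p : ℝ × EuclideanSpace ℝ (Fin m) => milnorFlow k p.1 p.2) :=
  (contDiff_milnorFlow k).continuous

/-! ### `|x⃗|²`, `|y⃗|²`, the quadratic form along the flow; `Q = ⟪F ·, ·⟫` -/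

/-- `|x⃗(Φ_t u)|² = e^{-2t} |x⃗(u)|²`. [cite: MilnorHCobordism1965, proof of Thm. 3.12 (PDF p. 18)] -/
theorem sqSumLT_milnorFlow (k : ℕ) (t : ℝ) (u : EuclideanSpace ℝ (Fin m)) :
    sqSumLT k (milnorFlow k t u) = Real.exp (-t) ^ 2 * sqSumLT k u := by
  simp only [sqSumLT, Finset.mul_sum]
  refine Finset.sum_congr rfl fun i hi => ?_
  rw [milnorFlow_apply, if_pos (Finset.mem_filter.1 hi).2]; ring

/-- `|y⃗(Φ_t u)|² = e^{2t} |y⃗(u)|²`. [cite: MilnorHCobordism1965, proof of Thm. 3.12 (PDF p. 18)] -/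
theorem sqSumGE_milnorFlow (k : ℕ) (t : ℝ) (u : EuclideanSpace ℝ (Fin m)) :
    sqSumGE k (milnorFlow k t u) = Real.exp t ^ 2 * sqSumGE k u := by
  simp only [sqSumGE, Finset.mul_sum]
  refine Finset.sum_congr rfl fun i hi => ?_
  rw [milnorFlow_apply, if_neg (not_lt.2 (Finset.mem_filter.1 hi).2)]; ring

/-- The quadratic form along the flow: `-e^{-2t}|x⃗|² + e^{2t}|y⃗|²`. [folklore] -/
theorem milnorQuadratic_milnorFlow (k : ℕ) (t : ℝ) (u : EuclideanSpace ℝ (Fin m)) :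
    milnorQuadratic k (milnorFlow k t u) =
      -(Real.exp (-t) ^ 2 * sqSumLT k u) + Real.exp t ^ 2 * sqSumGE k u := by
  rw [milnorQuadratic_eq, sqSumLT_milnorFlow, sqSumGE_milnorFlow]

/-- `|x⃗|² = (‖u‖² - Q(u)) / 2`. [folklore] -/
theorem sqSumLT_eq_norm_sq_sub (k : ℕ) (u : EuclideanSpace ℝ (Fin m)) :
    sqSumLT k u = (‖u‖ ^ 2 - milnorQuadratic k u) / 2 := by
  rw [milnorQuadratic_eq, ← sqSumLT_add_sqSumGE k u]; ring

/-- `|y⃗|² = (‖u‖² + Q(u)) / 2`. [folklore] -/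
theorem sqSumGE_eq_norm_sq_add (k : ℕ) (u : EuclideanSpace ℝ (Fin m)) :
    sqSumGE k u = (‖u‖ ^ 2 + milnorQuadratic k u) / 2 := by
  rw [milnorQuadratic_eq, ← sqSumLT_add_sqSumGE k u]; ring

/-- **Milnor's quadratic form is `⟪F u, u⟫`.** [folklore] -/
theorem milnorQuadratic_eq_inner (k : ℕ) (u : EuclideanSpace ℝ (Fin m)) :
    milnorQuadratic k u = inner ℝ (milnorModelField k u) u := by
  rw [PiLp.inner_apply, milnorQuadratic,
    ← Finset.sum_filter_add_sum_filter_not Finset.univ (fun i : Fin m => (i : ℕ) < k)]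
  have h : Finset.univ.filter (fun i : Fin m => k ≤ (i : ℕ)) =
      Finset.univ.filter (fun i : Fin m => ¬ (i : ℕ) < k) := by
    ext i; simp [not_lt]
  rw [h, ← Finset.sum_neg_distrib]
  congr 1
  · refine Finset.sum_congr rfl fun i hi => ?_
    simp [(Finset.mem_filter.1 hi).2, sq]
  · refine Finset.sum_congr rfl fun i hi => ?_
    simp [(Finset.mem_filter.1 hi).2, sq]

/-! ### Linear isometries commuting with the model field -/

section Symmetry

variable {k : ℕ} (S : EuclideanSpace ℝ (Fin m) ≃ₗᵢ[ℝ] EuclideanSpace ℝ (Fin m))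
  (hS : ∀ u, S (milnorModelField k u) = milnorModelField k (S u))

include hS

/-- **A linear isometry commuting with `F` preserves Milnor's quadratic form** (`Q(u) = ⟪F u, u⟫`). [folklore] -/
theorem milnorQuadratic_map_of_comm (u : EuclideanSpace ℝ (Fin m)) :
    milnorQuadratic k (S u) = milnorQuadratic k u := by
  rw [milnorQuadratic_eq_inner, milnorQuadratic_eq_inner, ← hS, LinearIsometryEquiv.inner_map_map]

/-- … hence preserves `|x⃗|²`. [folklore] -/
theorem sqSumLT_map_of_comm (u : EuclideanSpace ℝ (Fin m)) : sqSumLT k (S u) = sqSumLT k u := by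
  rw [sqSumLT_eq_norm_sq_sub, sqSumLT_eq_norm_sq_sub, milnorQuadratic_map_of_comm S hS,
    LinearIsometryEquiv.norm_map]

/-- … and `|y⃗|²`. [folklore] -/
theorem sqSumGE_map_of_comm (u : EuclideanSpace ℝ (Fin m)) : sqSumGE k (S u) = sqSumGE k u := by
  rw [sqSumGE_eq_norm_sq_add, sqSumGE_eq_norm_sq_add, milnorQuadratic_map_of_comm S hS,
    LinearIsometryEquiv.norm_map]

/-- **A linear isometry commuting with `F` commutes with the model flow** (`Φ_t` is
`cosh t · id + sinh t · F`). [folklore] -/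
theorem map_milnorFlow_of_comm (t : ℝ) (u : EuclideanSpace ℝ (Fin m)) :
    S (milnorFlow k t u) = milnorFlow k t (S u) := by
  simp only [milnorFlow_eq_cosh_smul_add_sinh_smul, map_add, LinearIsometryEquiv.map_smul, hS]

/-- The inverse isometry also commutes with `F`. [folklore] -/
theorem symm_comm_of_comm (u : EuclideanSpace ℝ (Fin m)) :
    S.symm (milnorModelField k u) = milnorModelField k (S.symm u) := by
  apply S.injective
  rw [LinearIsometryEquiv.apply_symm_apply, hS, LinearIsometryEquiv.apply_symm_apply]

/-- The inverse isometry commutes with the model flow. [folklore] -/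
theorem symm_map_milnorFlow_of_comm (t : ℝ) (u : EuclideanSpace ℝ (Fin m)) :
    S.symm (milnorFlow k t u) = milnorFlow k t (S.symm u) :=
  map_milnorFlow_of_comm S.symm (symm_comm_of_comm S hS) t u

end Symmetry

end Literature.Topology.FourManifolds
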